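import Mathlib
import HarnessLib
import Summits.NavierStokesRegularity.NavierStokesRegularity.Theorems.HalfSpaceWindowDoorCirculationCarryingRigidityDefs
import Summits.NavierStokesRegularity.NavierStokesRegularity.Theorems.HalfSpaceWindowDoorCirculationCarryingRigidityRotHeadLiouville
import Summits.NavierStokesRegularity.NavierStokesRegularity.Theorems.HalfSpaceWindowDoorCirculationCarryingRigidityAsymptoticPlanarity
import Summits.NavierStokesRegularity.NavierStokesRegularity.Theorems.PoloidalWindowDoorPoloidalWindowRigidityWindow
import Summits.NavierStokesRegularity.NavierStokesRegularity.Theorems.PoloidalWindowDoorPoloidalWindowRigidityFlat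
import Summits.NavierStokesRegularity.NavierStokesRegularity.Theorems.PoloidalWindowDoorPoloidalWindowRigidityClassSpaceTimeRates
import Literature.Analysis.FluidPDE.TypeIAncientMildClassical
import Literature.Analysis.FluidPDE.VorticityCalculus

/-!
# Route `HalfSpaceWindowDoor`, crux `CirculationCarryingRigidity` (stmt-NavierStokesRegularity-25311) — line
# `rot_bernoulli`, VII (SIGN-FREE row): NO door-class profile is even INSTANTANEOUSLY self-similar

LEAD ns-hsw-p1 g11 (cell pub-ns-dss).  The case `α = 0` of the rotation-corrected Bernoulli function is Tsai's head pressure,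
and the Liouville theorem of `…RotHeadLiouville` (`exists_eq_const_of_rotProfile`, hypothesis `α·tr(J∘DU) ≥ 0`, trivially
true at `α = 0`) needs NO sign.  Combined with the production of the profile system and of a linearly growing pressure from
the class (as in `…RotHeadInstant`): a door-class profile (`InDoorClass C v` — the class of BOTH doors `HalfSpaceWindowDoor`
and `PoloidalWindowDoor`, item 19708) whose time derivative at the ONE instant `t = −1` is the self-similar generator,

  `∂ₜv(−1, y) = ½ v(−1, y) + ½ (y·∇) v(−1, y)`   for all `y`,

vanishes identically (`eq_zero_of_instantSelfSimilar`).  This strengthens the tree's `…PoloidalWindowRigidityStrata.eq_zero_of_selfSimilar`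
(Tsai 1998 for profiles of Leray's backward form `v = lerayBackward a 0 U` on the WHOLE slab) to a ONE-INSTANT hypothesis: by
time-analyticity nothing is lost, but the statement is the one a census needs («an enemy is nowhere, at no instant, tangent to the
self-similar orbit through it»).  Corollaries: `not_isBackwardSingularPoint_of_instantSelfSimilar`,
`inner_curl_e3_eq_zero_of_instantSelfSimilar` (poloidal, for the W6 census), `hemisphereLiouvilleE3_of_instantSelfSimilar`.

WHAT THIS IS NOT: not a statement about Navier–Stokes regularity (Clay A); the door statements concern HYPOTHETICAL blow-up
profiles (KNSS ancient mild solutions); helper `--supports` 25311; the item stays OPEN at its research stub.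
-/

noncomputable section

-- the summit and its single sub-problem share the name (CONVENTIONS §1), as in every Theorems file
set_option linter.dupNamespace false

namespace Summit.NavierStokesRegularity.NavierStokesRegularity.Theorems.HalfSpaceWindowDoorCirculationCarryingRigidityInstantSelfSimilar

open Set Function Filter Topology InnerProductSpace
open scoped RealInnerProductSpace Laplacian ContDiff
open Literature.Analysis Literature.Analysis.FluidPDE
open Summit.NavierStokesRegularity.NavierStokesRegularity.Theorems.HalfSpaceWindowDoorCirculationCarryingRigidityDefs
  (InDoorClass SignE3 e3 HemisphereLiouvilleE3)
open Summit.NavierStokesRegularity.NavierStokesRegularity.Theorems.HalfSpaceWindowDoorCirculationCarryingRigidityRotHeadLiouville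
  (exists_eq_const_of_rotProfile)
open Summit.NavierStokesRegularity.NavierStokesRegularity.Theorems.HalfSpaceWindowDoorCirculationCarryingRigidityRotHead
  (rotGenL_skew)
open Summit.NavierStokesRegularity.NavierStokesRegularity.Theorems.HalfSpaceWindowDoorCirculationCarryingRigidityAsymptoticPlanarity
  (eq_zero_of_lineInvariant_slice)
open Summit.NavierStokesRegularity.NavierStokesRegularity.Theorems.PoloidalWindowDoorPoloidalWindowRigidityWindow
  (isTypeIAncientMild_of_class)
open Summit.NavierStokesRegularity.NavierStokesRegularity.Theorems.PoloidalWindowDoorPoloidalWindowRigidityClassSpaceTimeRates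
  (exists_pressureGradient_rate_of_class)
open Summit.NavierStokesRegularity.NavierStokesRegularity.Theorems.PoloidalWindowDoorPoloidalWindowRigidityFlat
  (not_backwardSingular_of_zero)

variable {C : ℝ} {v : ℝ → EuclideanSpace ℝ (Fin 3) → EuclideanSpace ℝ (Fin 3)}

/-- **No door-class profile is instantaneously self-similar.**  Let `v` be a door-class profile (no sign hypothesis) whose
time derivative at `t = −1` is the self-similar generator: `∂ₜv(−1,y) = ½v(−1,y) + ½(y·∇)v(−1,y)` for all `y`.  Then `v ≡ 0`
on the slab.  (The slice `U = v(−1)` then solves Leray's profile system with the classical pressure `P = p(−1)`, which grows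
at most linearly; Tsai's head pressure is a polynomially bounded subsolution, hence constant; `U` is bounded harmonic, hence
constant; ONE translation-invariant slice kills a door-class profile.) -/
theorem eq_zero_of_instantSelfSimilar (hv : InDoorClass C v)
    (hgen : ∀ y, deriv (fun τ => v τ y) (-1) = (1 / 2 : ℝ) • v (-1) y + (1 / 2 : ℝ) • fderiv ℝ (v (-1)) y y) :
    ∀ t < 0, ∀ x, v t x = 0 := by
  obtain ⟨hrate, hcont, hmild, hdiv⟩ := hv
  have hA : IsTypeIAncientMild C v := isTypeIAncientMild_of_class hrate hcont hmild hdiv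
  have h1 : (-1 : ℝ) < 0 := by norm_num
  have hmem : (-1 : ℝ) ∈ Ioo (-2 : ℝ) 0 := ⟨by norm_num, by norm_num⟩
  set U : EuclideanSpace ℝ (Fin 3) → EuclideanSpace ℝ (Fin 3) := v (-1) with hU
  have hU3 : ContDiff ℝ 3 U := contDiff_infty.1 (hA.contDiff_slice h1) 3
  have hdivU : VectorCalculus.IsDivFree U := hdiv (-1) h1
  have hUbdd : ∃ M : ℝ, ∀ y, ‖U y‖ ≤ M := ⟨C, fun y => by
    have h := hA.norm_le h1 y
    rwa [neg_neg, Real.sqrt_one, div_one] at h⟩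
  -- a classical pressure on the window `(−2, 0)`, its gradient rate, its linear growth at `t = −1`
  obtain ⟨p, hns⟩ := hA.exists_isClassicalNSSolutionOn_Ioo (t₀ := -2) (by norm_num)
  obtain ⟨K, hK0, hK⟩ := exists_pressureGradient_rate_of_class hrate hcont hmild
  have hgradK : ∀ y, ‖gradient (p (-1)) y‖ ≤ K := fun y => by
    have h := hK (-2) p hns (-1) hmem y
    rwa [neg_neg, Real.sqrt_one, mul_one, div_one] at h
  have hP2 : ContDiff ℝ 2 (p (-1)) := (hns.contDiff_pressure hmem).of_le (by norm_cast)
  have hPd : Differentiable ℝ (p (-1)) := (hP2.of_le one_le_two).differentiable one_ne_zero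
  have hfd : ∀ z, ‖fderiv ℝ (p (-1)) z‖ ≤ K := fun z => by
    refine ContinuousLinearMap.opNorm_le_bound _ hK0 fun w => ?_
    have h : fderiv ℝ (p (-1)) z w = ⟪gradient (p (-1)) z, w⟫ := by
      rw [gradient, InnerProductSpace.toDual_symm_apply]
    rw [h]
    exact (abs_real_inner_le_norm _ _).trans (mul_le_mul_of_nonneg_right (hgradK z) (norm_nonneg _))
  have hPpoly : ∃ K' : ℝ, ∃ N : ℕ, ∀ y, |p (-1) y| ≤ K' * (1 + ‖y‖) ^ N := by
    refine ⟨|p (-1) 0| + K, 1, fun y => ?_⟩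
    have hmv : ‖p (-1) y - p (-1) 0‖ ≤ K * ‖y - 0‖ :=
      (convex_univ).norm_image_sub_le_of_norm_fderiv_le (fun z _ => hPd z) (fun z _ => hfd z) (mem_univ 0) (mem_univ y)
    rw [sub_zero, Real.norm_eq_abs] at hmv
    have h2 : |p (-1) y| ≤ |p (-1) 0| + K * ‖y‖ := by
      have := abs_sub_abs_le_abs_sub (p (-1) y) (p (-1) 0)
      linarith
    rw [pow_one]
    nlinarith [abs_nonneg (p (-1) 0), norm_nonneg y]
  -- Leray's profile system at the slice (the case `α = 0` of the rotated system)
  have heq : ∀ y, -((1 : ℝ) • (Δ U) y) + (1 / 2 : ℝ) • U y + (1 / 2 : ℝ) • fderiv ℝ U y y + convect U U y +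
      gradient (p (-1)) y + (0 : ℝ) • (rotGenL (U y) - fderiv ℝ U y (rotGenL y)) = 0 := fun y => by
    have hmom := hns.momentum (-1) hmem y
    simp only [one_smul, Pi.zero_apply, add_zero] at hmom
    have htd : timeDerivWithin (Ioo (-2 : ℝ) 0) v (-1) y = deriv (fun τ => v τ y) (-1) := by
      rw [timeDerivWithin, derivWithin_of_isOpen isOpen_Ioo hmem]
    rw [htd, hgen y] at hmom
    rw [← sub_eq_zero] at hmom
    rw [zero_smul, add_zero, one_smul, ← hmom]
    abel
  obtain ⟨c, hc⟩ := exists_eq_const_of_rotProfile one_pos (by norm_num : (0 : ℝ) < 1 / 2) rotGenL_skew hU3 hP2 hdivU heq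
    hUbdd hPpoly (fun y => by rw [zero_mul])
  have he3 : e3 ≠ 0 := fun h => by
    have h2 := congrArg (fun w : EuclideanSpace ℝ (Fin 3) => w 2) h
    simp [e3] at h2
  exact eq_zero_of_lineInvariant_slice hA h1 he3 fun x θ => by
    change U (x + θ • e3) = U x
    rw [hc, hc]

/-- … hence NOT backward singular at the apex. -/
theorem not_isBackwardSingularPoint_of_instantSelfSimilar (hv : InDoorClass C v)
    (hgen : ∀ y, deriv (fun τ => v τ y) (-1) = (1 / 2 : ℝ) • v (-1) y + (1 / 2 : ℝ) • fderiv ℝ (v (-1)) y y) :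
    ¬ IsBackwardSingularPoint v 0 :=
  not_backwardSingular_of_zero (eq_zero_of_instantSelfSimilar hv hgen)

/-- … and POLOIDAL along `e₃` (indeed zero; the row of the W6 census). -/
theorem inner_curl_e3_eq_zero_of_instantSelfSimilar (hv : InDoorClass C v)
    (hgen : ∀ y, deriv (fun τ => v τ y) (-1) = (1 / 2 : ℝ) • v (-1) y + (1 / 2 : ℝ) • fderiv ℝ (v (-1)) y y) :
    ∀ s < 0, ∀ y, ⟪curl (v s) y, e3⟫ = 0 := by
  intro s hs y
  have hz : v s = 0 := funext fun x => eq_zero_of_instantSelfSimilar hv hgen s hs x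
  rw [hz, curl_zero]
  simp

/-- **W6 = `HemisphereLiouvilleE3` RESTRICTED TO INSTANTANEOUSLY SELF-SIMILAR PROFILES** (hypotheses of `HemisphereLiouvilleE3`
verbatim — the sign is idle here — plus the one-instant identity). -/
theorem hemisphereLiouvilleE3_of_instantSelfSimilar (C : ℝ) (v : ℝ → EuclideanSpace ℝ (Fin 3) → EuclideanSpace ℝ (Fin 3))
    (hrate : HasTypeITimeDecay C v) (hcont : ContinuousOn (Function.uncurry v) (Set.Iio (0 : ℝ) ×ˢ Set.univ))
    (hmild : ∀ s t : ℝ, s < t → t < 0 → ∀ x,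
      v t x = UnboundedOperators.heatExtension (v s) (t - s) x - oseenDuhamel 1 s v v t x)
    (hdiv : ∀ t < 0, VectorCalculus.IsDivFree (v t)) (_hsign : ∀ s < 0, ∀ y, 0 ≤ ⟪curl (v s) y, e3⟫)
    (hgen : ∀ y, deriv (fun τ => v τ y) (-1) = (1 / 2 : ℝ) • v (-1) y + (1 / 2 : ℝ) • fderiv ℝ (v (-1)) y y) :
    ∀ s < 0, ∀ y, ⟪curl (v s) y, e3⟫ = 0 :=
  inner_curl_e3_eq_zero_of_instantSelfSimilar ⟨hrate, hcont, hmild, hdiv⟩ hgen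

end Summit.NavierStokesRegularity.NavierStokesRegularity.Theorems.HalfSpaceWindowDoorCirculationCarryingRigidityInstantSelfSimilar

end
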